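import Summits.QuantumFields.BalabanUV.Beta.GAN24.Entry110GDivCubic
import Summits.QuantumFields.BalabanUV.Beta.GAN24.Entry110LapCubic

/-!
# G-an2-4 ∕ (CONV-C), INTERFACE REQUEST (B5-1115-TABLE): [B5] (1.115) GLOBAL SUP ENTRIES «|∇GJ|, |G∇*J|, |ΔGJ| ≤ O(1)|J|» for
# `G = Δ_1⁻¹` AT `U = 1`, `a = 1`, ON EVERY CUBIC UNIT TORUS, UNIFORMLY IN THE SPACING — the block resummation of the (1.110) per-block
# bounds of `Entry110GradCubic` ∕ `Entry110GDivCubic` ∕ `Entry110LapCubic`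

G-an2-4 formalisation swarm `b2b-balaban-gan24-formalise-*`, leaf prover 04 (gen 46), crux team (2) under the coordinator ruling
«YM REDIRECT» (e34b3e0c); toward the road-P2 crux prover's **INTERFACE REQUEST G-an2-4: (B5-1115-TABLE)** (unit `b2b-balaban-gan24-p2`
gen 28, `HOME/INBOX.md` 2026-08-21T05:44Z), the `ℓ^∞ → ℓ^∞` (sup-norm, (1.108)) half of its item (H) ∕ of [B5] (1.115) «|GJ|, |∇GJ|,
|G∇*J|, |ΔGJ| ≤ O(1)|J|» (p. 36; the Hölder halves (1.116)–(1.117) are NOT typed anywhere and NOT touched here).  Entry 1 is pv15's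
`B5G115SupBound.norm_DeltaA_one_inv_mulVec_le_global` (every torus).  THIS FILE: entries 2–4 at `a = 1` on CUBIC unit tori, by
resumming the per-block row bounds of the three `…Cubic` files over the blocks of the unit torus (pv15's block swap
`B5G110BlockRowSum.sum_blockOf_mul` + the volume-uniform torus sum `B5Hk163TorusHolderRate.sum_exp_torusSupNorm_sub_rep_le`):
 * §1 **`norm_mulVec_le_of_block_row_sum`** (ANY torus, ANY matrix): per-block row bound with rate `δ > 0` ⇒
   `‖(K J)(i)‖ ≤ B₁·K_{d+1}(δ)·B` for every `J` with `|J| ≤ B` and every `i` (no support hypothesis);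
 * §2 ENDs **`norm_fdiff_inv_mulVec_le_cubic`**, **`norm_inv_fdiffH_mulVec_le_cubic`**, **`norm_Lap_inv_mulVec_le_cubic`**: `∃ C > 0` (function
   of `d`) with, for every `n ≥ 1`, every cubic unit torus `Π_μ ℤ/N₀`, (every direction `ν`,) every `J` with `|J| ≤ B` and every site∕component
   `i`: `‖(∇_ν (Δ_1⁻¹ J))(i)‖ ≤ C·B`, `‖(Δ_1⁻¹ (∇_ν^* J))(i)‖ ≤ C·B`, `‖(Δ (Δ_1⁻¹ J))(i)‖ ≤ C·B` — the `ℓ^∞ → ℓ^∞` operator norms of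
   `∇_νG`, `G∇_ν^*`, `ΔG` are bounded by a function of `d` alone, UNIFORMLY in `n` and in the (cubic) volume.

HONEST SCOPE.  `a = 1`, `U = 1`, CUBIC unit tori; sup-norm halves only (no Hölder, no `L²` entries (1.112)–(1.114)); constants NE3's
existential times `latticeConst`; nothing printed asserted — [B5] `Balaban1984PropagatorsI` p. 36 (1.115) is a TEXT LOCATION; bookkeeping
over the lineage's `…Cubic` files (whose analysis is t4-ne3-p1's).  No `def`, no `def … : Prop`, no `sorry`.  NOT (CONV-C), NEVER «G-an2-4
closed», NOT NE2 ∕ NE3, NOT D1, NOT BetaPertH, NOT continuum, NOT Clay; not in print — our bookkeeping.  ABSOLUTE RULE of the cell kept.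
HONEST DEPENDENCY: continuum YM on T⁴ ⇐ BetaPertH ∧ nine spine estimates (0/9 proved); BetaPertH ⇐ (D1) ∧ (D4) ∧ CAP+tail; G-an2-4
gates asym, D1 and NE2/3/4.
-/

noncomputable section

open scoped BigOperators ComplexConjugate Matrix
open Finset

namespace Summit.QuantumFields.BalabanUV.Beta.GAN24.Entry115SupCubic

open Literature.MathematicalPhysics.QuantumFieldTheory.Balaban1983to89
open B5Prop11Plancherel (Tor fine fdiff)
open B5Prop11Lower (Lap)
open B5Blocks16 (blockOf)
open B6LowerBound2153Torus (rep)
open B5DeltaA169 (DeltaA)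
open B4TorusKernel.MultiPeriod (torusSupNorm)
open B4Sect5Proof (latticeConst latticeConst_nonneg)
open B5Hk163TorusHolderRate (sum_exp_torusSupNorm_sub_rep_le)
open B5G110BlockRowSum (sum_blockOf_mul)
open Summit.QuantumFields.BalabanUV.T4Continuum
open Entry110GradCubic Entry110GDivCubic Entry110LapCubic

variable {d : ℕ}

/-! ## §1 Per-block row sums with decay ⇒ a volume-uniform `ℓ^∞ → ℓ^∞` bound (any torus, any matrix) -/

/-- **PER-BLOCK ROW SUMS WITH DECAY ⇒ GLOBAL SUP BOUND** (any torus `M`, any spacing, any matrix `K` on Bałaban's fine torus): if every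
row `i` has block row sums `Σ_{x′ : blockOf x′ = y′} ‖K(i,x′)‖ ≤ B₁·e^{−δ·|rep(blockOf i) − rep y′|_{T₁,∞}}` with `δ > 0`, then for every `J`
with `|J| ≤ B` and every `i`: `‖(K J)(i)‖ ≤ B₁·K_{d+1}(δ)·B` (`K_{d+1} = latticeConst (d+1)`, independent of the volume). [folklore] -/
theorem norm_mulVec_le_of_block_row_sum (n : ℕ) [NeZero n] (M : Fin (d + 1) → ℕ) [∀ μ, NeZero (M μ)]
    (K : Matrix (Tor (fine n M) × Fin (d + 1)) (Tor (fine n M) × Fin (d + 1)) ℂ) {B₁ δ : ℝ} (hδ : 0 < δ)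
    (hK : ∀ (i : Tor (fine n M) × Fin (d + 1)) (y' : Tor M),
      ∑ x' : Tor (fine n M) × Fin (d + 1), (if blockOf n M x'.1 = y' then ‖K i x'‖ else 0)
        ≤ B₁ * Real.exp (-(δ * torusSupNorm M (rep M (blockOf n M i.1) - rep M y'))))
    (J : Tor (fine n M) × Fin (d + 1) → ℂ) {B : ℝ} (hJB : ∀ j, ‖J j‖ ≤ B) (i : Tor (fine n M) × Fin (d + 1)) :
    ‖(K *ᵥ J) i‖ ≤ B₁ * latticeConst (d + 1) δ * B := by
  have hB0 : 0 ≤ B := (norm_nonneg _).trans (hJB i)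
  -- the constant is nonnegative (the hypothesis at the own block)
  have hB1 : 0 ≤ B₁ := by
    have h0 : (0 : ℝ) ≤ ∑ x' : Tor (fine n M) × Fin (d + 1), (if blockOf n M x'.1 = blockOf n M i.1 then ‖K i x'‖ else 0) :=
      Finset.sum_nonneg fun x' _ => by split_ifs <;> simp
    have hpos : 0 < Real.exp (-(δ * torusSupNorm M (rep M (blockOf n M i.1) - rep M (blockOf n M i.1)))) := Real.exp_pos _
    exact (mul_nonneg_iff_of_pos_right hpos).mp (h0.trans (hK i _))
  -- the full row sum, resummed over blocks
  have hrow : ∑ j, ‖K i j‖ ≤ B₁ * latticeConst (d + 1) δ := by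
    have hswap := sum_blockOf_mul n M (fun _ => (1 : ℝ)) (fun j => ‖K i j‖)
    simp only [one_mul] at hswap
    rw [hswap]
    calc ∑ y' : Tor M, ∑ j, (if blockOf n M j.1 = y' then ‖K i j‖ else 0)
        ≤ ∑ y' : Tor M, B₁ * Real.exp (-(δ * torusSupNorm M (rep M (blockOf n M i.1) - rep M y'))) :=
          Finset.sum_le_sum fun y' _ => hK i y'
      _ = B₁ * ∑ y' : Tor M, Real.exp (-(δ * torusSupNorm M (rep M (blockOf n M i.1) - rep M y'))) := by
          rw [Finset.mul_sum]
      _ ≤ B₁ * latticeConst (d + 1) δ :=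
          mul_le_mul_of_nonneg_left (sum_exp_torusSupNorm_sub_rep_le M hδ (rep M (blockOf n M i.1))) hB1
  calc ‖(K *ᵥ J) i‖ = ‖∑ j, K i j * J j‖ := by simp only [Matrix.mulVec, dotProduct]
    _ ≤ ∑ j, ‖K i j * J j‖ := norm_sum_le _ _
    _ ≤ ∑ j, ‖K i j‖ * B := Finset.sum_le_sum fun j _ => by
        rw [norm_mul]; exact mul_le_mul_of_nonneg_left (hJB j) (norm_nonneg _)
    _ = (∑ j, ‖K i j‖) * B := by rw [Finset.sum_mul]
    _ ≤ B₁ * latticeConst (d + 1) δ * B := mul_le_mul_of_nonneg_right hrow hB0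

/-! ## §2 ENDs: the three global sup entries at `a = 1` on cubic tori -/

/-- **(1.115), SECOND ENTRY «|∇GJ| ≤ O(1)|J|», `a = 1`, CUBIC tori, n-UNIFORM**: `∃ C > 0` (function of `d`) such that for every
`n ≥ 1`, every cubic unit torus, every direction `ν`, every `J` with `|J| ≤ B` and every `i`: `‖(∇_ν·Δ_1⁻¹ J)(i)‖ ≤ C·B`.
(Location of the printed text: [B5] `Balaban1984PropagatorsI` p. 36, (1.115); the typed inequality is not a quotation.) [folklore] -/
theorem norm_fdiff_inv_mulVec_le_cubic :
    ∃ C : ℝ, 0 < C ∧ ∀ (n N₀ : ℕ) [NeZero n] [NeZero N₀] (ν : Fin (d + 1))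
      (J : Tor (fine n (fun _ : Fin (d + 1) => N₀)) × Fin (d + 1) → ℂ) (B : ℝ), (∀ j, ‖J j‖ ≤ B) →
        ∀ i : Tor (fine n (fun _ : Fin (d + 1) => N₀)) × Fin (d + 1),
          ‖(fdiff (fine n (fun _ : Fin (d + 1) => N₀)) (n : ℂ) ν *ᵥ ((DeltaA n (fun _ : Fin (d + 1) => N₀) 1)⁻¹ *ᵥ J)) i‖
            ≤ C * B := by
  obtain ⟨B₁, δ, hB, hδ, hblock⟩ := block_row_sum_fdiff_inv_le_cubic (d := d)
  have hK := latticeConst_nonneg (d + 1) hδ.le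
  refine ⟨B₁ * latticeConst (d + 1) δ + 1, by positivity, fun n N₀ _ _ ν J B hJB i => ?_⟩
  have hB0 : 0 ≤ B := (norm_nonneg _).trans (hJB i)
  rw [Matrix.mulVec_mulVec]
  calc _ ≤ B₁ * latticeConst (d + 1) δ * B :=
        norm_mulVec_le_of_block_row_sum n (fun _ => N₀) _ hδ (fun i' y' => hblock n N₀ ν i' y') J hJB i
    _ ≤ (B₁ * latticeConst (d + 1) δ + 1) * B := by nlinarith

/-- **(1.115), THIRD ENTRY «|G∇*J| ≤ O(1)|J|», `a = 1`, CUBIC tori, n-UNIFORM**: `∃ C > 0` (function of `d`) such that for every `n ≥ 1`,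
every cubic unit torus, every direction `ν`, every `J` with `|J| ≤ B` and every `i`: `‖(Δ_1⁻¹·∇_ν^* J)(i)‖ ≤ C·B`. [folklore] -/
theorem norm_inv_fdiffH_mulVec_le_cubic :
    ∃ C : ℝ, 0 < C ∧ ∀ (n N₀ : ℕ) [NeZero n] [NeZero N₀] (ν : Fin (d + 1))
      (J : Tor (fine n (fun _ : Fin (d + 1) => N₀)) × Fin (d + 1) → ℂ) (B : ℝ), (∀ j, ‖J j‖ ≤ B) →
        ∀ i : Tor (fine n (fun _ : Fin (d + 1) => N₀)) × Fin (d + 1),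
          ‖((DeltaA n (fun _ : Fin (d + 1) => N₀) 1)⁻¹ *ᵥ ((fdiff (fine n (fun _ : Fin (d + 1) => N₀)) (n : ℂ) ν)ᴴ *ᵥ J)) i‖
            ≤ C * B := by
  obtain ⟨B₂, δ, hB, hδ, hblock⟩ := block_row_sum_inv_fdiffH_le_cubic (d := d)
  have hK := latticeConst_nonneg (d + 1) hδ.le
  refine ⟨B₂ * latticeConst (d + 1) δ + 1, by positivity, fun n N₀ _ _ ν J B hJB i => ?_⟩
  have hB0 : 0 ≤ B := (norm_nonneg _).trans (hJB i)
  rw [Matrix.mulVec_mulVec]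
  calc _ ≤ B₂ * latticeConst (d + 1) δ * B :=
        norm_mulVec_le_of_block_row_sum n (fun _ => N₀) _ hδ (fun i' y' => hblock n N₀ ν i' y') J hJB i
    _ ≤ (B₂ * latticeConst (d + 1) δ + 1) * B := by nlinarith

/-- **(1.115), FOURTH ENTRY «|ΔGJ| ≤ O(1)|J|», `a = 1`, CUBIC tori, n-UNIFORM**: `∃ C > 0` (function of `d`) such that for every `n ≥ 1`,
every cubic unit torus, every `J` with `|J| ≤ B` and every `i`: `‖(Δ·Δ_1⁻¹ J)(i)‖ ≤ C·B`. [folklore] -/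
theorem norm_Lap_inv_mulVec_le_cubic :
    ∃ C : ℝ, 0 < C ∧ ∀ (n N₀ : ℕ) [NeZero n] [NeZero N₀]
      (J : Tor (fine n (fun _ : Fin (d + 1) => N₀)) × Fin (d + 1) → ℂ) (B : ℝ), (∀ j, ‖J j‖ ≤ B) →
        ∀ i : Tor (fine n (fun _ : Fin (d + 1) => N₀)) × Fin (d + 1),
          ‖(Lap n (fun _ : Fin (d + 1) => N₀) *ᵥ ((DeltaA n (fun _ : Fin (d + 1) => N₀) 1)⁻¹ *ᵥ J)) i‖ ≤ C * B := by
  obtain ⟨B₄, δ, hB, hδ, hblock⟩ := block_row_sum_Lap_mul_inv_le_cubic (d := d)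
  have hK := latticeConst_nonneg (d + 1) hδ.le
  refine ⟨B₄ * latticeConst (d + 1) δ + 1, by positivity, fun n N₀ _ _ J B hJB i => ?_⟩
  have hB0 : 0 ≤ B := (norm_nonneg _).trans (hJB i)
  rw [Matrix.mulVec_mulVec]
  calc _ ≤ B₄ * latticeConst (d + 1) δ * B :=
        norm_mulVec_le_of_block_row_sum n (fun _ => N₀) _ hδ (fun i' y' => hblock n N₀ i' y') J hJB i
    _ ≤ (B₄ * latticeConst (d + 1) δ + 1) * B := by nlinarith

end Summit.QuantumFields.BalabanUV.Beta.GAN24.Entry115SupCubic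

end
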